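import Literature.MathematicalPhysics.KineticTheory.TaggedSphereHydrodynamicReduction
import HarnessLib

/-!
# BGSR (6.3) for a single Fourier mode, I: separation of variables and the velocity profile
(Bodineau–Gallagher–Saint-Raymond, Invent. Math. 203 (2016) = arXiv:1305.3397v2, §6.1, (6.3);
a layer of the proof of the named fact
`Literature.MathematicalPhysics.KineticTheory.bgsr_hydrodynamicLimit_mode` of
`TaggedSphereHydrodynamicReduction`, to which (6.3) `bgsr_hydrodynamicLimit` has been reduced)

`bgsr_hydrodynamicLimit_mode` is the diffusive limit (6.3) of BGSR's linear Boltzmann equation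
(1.3) `∂ₜ φ + v·∇ₓ φ = -α L φ` on `T^d` for the elementary single-mode data
`ρ⁰ = 1 + a₁ cos(2π n·x) + a₂ sin(2π n·x)`, `n ≠ 0`. For such data both flows are explicit in `x`:
this file separates the variables and reduces (6.3) to a statement about one complex-valued
function of `(t, v)`, the *velocity profile* `ĝ_n` of the mode (`modeProfile`).

## Main results

* `linearBoltzmannSeries_translate` — translation covariance of the collision series on `T^d`
  (pure algebra of the terms: free flight commutes with translations), and
  `linearBoltzmannSeries_affine` — linearity of the series over signed affine combinations
  `f = K + c₁ g₁ + c₂ g₂` of nonnegative data (from additivity over nonnegative data,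
  `linearBoltzmannSeries_add_torus`, and `φ[c] = c`).
* `modeProfile n β α t v = ĝ_n(t, v) ∈ ℂ`, read off at `x = 0` from the collision series of the
  two elementary data `1 + cos(2π n·x)`, `1 + sin(2π n·x)`, and the **separation of variables**
  `linearBoltzmannSeries_modeDensity`: for `a₁² + a₂² ≤ 1`,
  `φ[ρ_{n,a₁,a₂}](t, x, v) = 1 + a₁ Re(e_n(x) ĝ_n(t, v)) + a₂ Im(e_n(x) ĝ_n(t, v))`
  (translating the datum rotates `(a₁, a₂)`, `modeDensity_add`). Elementary properties:
  `|Re ĝ_n|, |Im ĝ_n| ≤ 1` (maximum principle), `ĝ_n(0) = 1`, joint continuity.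
* `hasDerivAt_modeProfile` — **the velocity-only equation**: for `t > 0` and every `v`,
  `∂ₜ ĝ_n(t, v) = -i ω_n(v) ĝ_n + α (K⁺_β ĝ_n(t, ·)(v) - a_β(v) ĝ_n)`, `ω_n(v) = 2π n·v`
  (`modePhase`), `K⁺_β` the gain operator acting componentwise (`cgain`): Duhamel's formula for
  the series along the free flight `s ↦ s v` (`LinearBoltzmannData.linearBoltzmannSeries_duhamel`),
  the fundamental theorem of calculus and the separation of variables inside `K⁺_β`. The
  right-hand side as a function of all `(t, v)` is `modeDeriv` (jointly continuous, of size
  `≤ 2|ω_n(v)| + 6 α a_β(v)`).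
* `torusHeatSolution_modeDensity` — the heat flow of the mode is
  `1 + e^{-4π² κ |n|² τ} (a₁ cos + a₂ sin)(2π n·x)` (`charFun_stdGaussian`).
* `bgsr_hydrodynamicLimit_mode_of_profile` — **the reduction**: (6.3) for single modes follows
  from the *relaxation of the profile*, `sup_v M_β(v) |ĝ_n(ατ, v) - e^{-4π² κ_β |n|² τ}| → 0`
  uniformly in `τ ∈ [0, T]` as `α → ∞` (every solution in the class is the collision series,
  `IsTaggedLinearBoltzmannSolution.eq_linearBoltzmannSeries`; `|a₁ Re z + a₂ Im z| ≤ |z|`).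
  The relaxation itself (an `L²(M_β dv)` energy estimate built on the corrector `b` of (6.5),
  the spectral gap and isotropy of `TaggedSphereSpectralGap`, followed by one Duhamel iteration
  with Grad's bound on the gain kernel) is the object of the sibling files.

## Design choices

* The profile is complex-valued (`ℂ`-valued functions of `v`, the gain operator acting on real
  and imaginary parts, `cgain`); its real and imaginary parts are collision series, so all the
  real-variable API of `TaggedLinearBoltzmannSeries` (maximum principle, continuity, Duhamel
  forms, uniqueness) applies verbatim.
* `ω_n` is written with `Torus.latticeVec n ∈ ℤ^d ⊂ ℝ^d` of `FlatTorus`, whence the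
  `[DecidableEq d]` assumptions; `|n|² = ‖latticeVec n‖²`.
* Nothing here uses `n ≠ 0` or `d ≥ 2`; these enter only through the corrector and the gap.

## References

* T. Bodineau, I. Gallagher, L. Saint-Raymond, *The Brownian motion as the limit of a
  deterministic system of hard-spheres*, Invent. Math. 203 (2016) 493–553 = arXiv:1305.3397v2,
  (1.3), §6.1.1 (6.3), §6.1.2 (`L = a_β - K`), (2.11).
* A. Bensoussan, J.-L. Lions, G. Papanicolaou, *Boundary layers and homogenization of transport
  processes*, Publ. RIMS 15 (1979) 53–157 (BGSR's [6]: the diffusive limit of linear transport).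
-/

open MeasureTheory Metric Set Filter Topology ProbabilityTheory
open scoped InnerProductSpace ENNReal ComplexConjugate

namespace Literature.MathematicalPhysics.KineticTheory

noncomputable section

open Literature.Analysis.FunctionSpaces (maxwellianBeta maxwellianBeta_pos)

variable {d : Type*} [Fintype d]

local notation "𝔼" => EuclideanSpace ℝ d
local notation "𝕋" => UnitAddTorus d
local notation "𝔾" => Literature.Analysis.FluidPDE.Torus.geometry d

/-! ## Translation covariance of the collision series on the torus -/

/-- Free flight on the torus geometry is `x + proj w`. [folklore] -/
theorem torusGeometry_translate (x : 𝕋) (w : 𝔼) :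
    (𝔾).translate x w = x + Literature.Analysis.FunctionSpaces.Torus.proj w := rfl

/-- **Translation covariance of the collision terms**: translating the datum translates every
term of the collision series (the torus is a group and free flight commutes with translations).
[folklore] -/
theorem linearBoltzmannTerm_translate (β α : ℝ) (f₀ : 𝕋 → 𝔼 → ℝ) (y : 𝕋) (k : ℕ) (t : ℝ)
    (x : 𝕋) (v : 𝔼) :
    linearBoltzmannTerm 𝔾 β α (fun z w => f₀ (z + y) w) k t x v =
      linearBoltzmannTerm 𝔾 β α f₀ k t (x + y) v := by
  induction k generalizing t x v with
  | zero =>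
    simp only [linearBoltzmannTerm_zero, torusGeometry_translate]
    rw [add_right_comm]
  | succ k ih =>
    simp only [linearBoltzmannTerm_succ, gainDuhamel, torusGeometry_translate]
    refine intervalIntegral.integral_congr fun s _ => ?_
    simp only [ih, add_right_comm x _ y]

/-- **Translation covariance of the collision series** on `T^d`:
`φ[f₀(· + y)](t, x, v) = φ[f₀](t, x + y, v)`. [folklore] -/
theorem linearBoltzmannSeries_translate (β α : ℝ) (f₀ : 𝕋 → 𝔼 → ℝ) (y : 𝕋) (t : ℝ) (x : 𝕋)
    (v : 𝔼) :
    linearBoltzmannSeries 𝔾 β α (fun z w => f₀ (z + y) w) t x v =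
      linearBoltzmannSeries 𝔾 β α f₀ t (x + y) v := by
  simp only [linearBoltzmannSeries, linearBoltzmannTerm_translate]

/-- Before time `0` the collision series is the datum (times are clamped at `t⁺`). [folklore] -/
theorem linearBoltzmannSeries_of_nonpos {X : Type*} (G : Literature.Analysis.FluidPDE.Geometry d X)
    (β α : ℝ) (f₀ : X → 𝔼 → ℝ) {t : ℝ} (ht : t ≤ 0) (x : X) (v : 𝔼) :
    linearBoltzmannSeries G β α f₀ t x v = f₀ x v := by
  rw [linearBoltzmannSeries, tsum_eq_single 0]
  · simp [max_eq_right ht]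
  · intro n hn
    obtain ⟨k, rfl⟩ := Nat.exists_eq_succ_of_ne_zero hn
    rw [linearBoltzmannTerm_succ, gainDuhamel]
    simp [max_eq_right ht]

/-! ## Fourier monomials: multiplicativity and evaluation along free flight -/

/-- The phase velocity `ω_n(v) = 2π n·v` of the mode `n ∈ ℤ^d` along the free flight with
velocity `v` (`e_n(x + t v) = e^{i ω_n(v) t} e_n(x)`), written with the lattice vector
`latticeVec n ∈ ℤ^d ⊂ ℝ^d` of `Literature.Analysis.FunctionSpaces.FlatTorus`. [folklore] -/
def modePhase [DecidableEq d] (n : d → ℤ) (v : 𝔼) : ℝ :=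
  2 * Real.pi * ⟪Literature.Analysis.FunctionSpaces.Torus.latticeVec n, v⟫_ℝ

/-- `ω_n(v) = 2π ∑ᵢ nᵢ vᵢ`. [folklore] -/
theorem modePhase_eq_sum [DecidableEq d] (n : d → ℤ) (v : 𝔼) :
    modePhase n v = 2 * Real.pi * ∑ i, (n i : ℝ) * v i := by
  rw [modePhase, inner_eq_sum_apply]
  simp only [Literature.Analysis.FunctionSpaces.Torus.latticeVec_apply]

/-- `ω_n` is linear: `ω_n(t v) = t ω_n(v)`. [folklore] -/
theorem modePhase_smul [DecidableEq d] (n : d → ℤ) (t : ℝ) (v : 𝔼) : modePhase n (t • v) = t * modePhase n v := by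
  simp only [modePhase, inner_smul_right]
  ring

/-- `ω_n(-v) = -ω_n(v)`. [folklore] -/
theorem modePhase_neg [DecidableEq d] (n : d → ℤ) (v : 𝔼) : modePhase n (-v) = -modePhase n v := by
  simp only [modePhase, inner_neg_right]
  ring

/-- `|ω_n(v)| ≤ 2π |n| |v|`. [folklore] -/
theorem abs_modePhase_le [DecidableEq d] (n : d → ℤ) (v : 𝔼) :
    |modePhase n v| ≤ 2 * Real.pi * ‖Literature.Analysis.FunctionSpaces.Torus.latticeVec n‖ * ‖v‖ := by
  have h := abs_real_inner_le_norm (Literature.Analysis.FunctionSpaces.Torus.latticeVec n) v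
  have hπ := Real.pi_pos
  rw [modePhase, abs_mul, abs_of_pos (by positivity : (0 : ℝ) < 2 * Real.pi)]
  nlinarith [abs_nonneg ⟪Literature.Analysis.FunctionSpaces.Torus.latticeVec n, v⟫_ℝ]

/-- `ω_n` is continuous. [folklore] -/
@[fun_prop]
theorem continuous_modePhase [DecidableEq d] (n : d → ℤ) : Continuous (modePhase (d := d) n) := by
  unfold modePhase
  fun_prop

/-- The Fourier monomials are characters of `T^d`: `e_n(x + y) = e_n(x) e_n(y)`. [folklore] -/
theorem mFourier_add_apply (n : d → ℤ) (x y : 𝕋) :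
    UnitAddTorus.mFourier n (x + y) = UnitAddTorus.mFourier n x * UnitAddTorus.mFourier n y := by
  simp only [UnitAddTorus.mFourier, ContinuousMap.coe_mk, Pi.add_apply, fourier_apply, zsmul_add,
    AddCircle.toCircle_add, Circle.coe_mul, Finset.prod_mul_distrib]

/-- `e_n(0) = 1`. [folklore] -/
theorem mFourier_apply_zero (n : d → ℤ) : UnitAddTorus.mFourier n (0 : 𝕋) = 1 := by
  simp only [UnitAddTorus.mFourier, ContinuousMap.coe_mk, Pi.zero_apply, fourier_eval_zero,
    Finset.prod_const_one]

/-- **Fourier monomials along the covering map**: `e_n(proj w) = exp(i ω_n(w))`. [folklore] -/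
theorem mFourier_proj_modePhase [DecidableEq d] (n : d → ℤ) (w : 𝔼) :
    UnitAddTorus.mFourier n (Literature.Analysis.FunctionSpaces.Torus.proj w) =
      Complex.exp (modePhase n w * Complex.I) := by
  simp only [UnitAddTorus.mFourier, ContinuousMap.coe_mk,
    Literature.Analysis.FunctionSpaces.Torus.proj_apply, fourier_coe_apply, Complex.ofReal_one, div_one]
  rw [← Complex.exp_sum, modePhase_eq_sum]
  congr 1
  rw [Finset.mul_sum]
  push_cast
  rw [Finset.sum_mul]
  refine Finset.sum_congr rfl fun i _ => ?_
  ring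

/-- `cos² + sin² = 1` for a Fourier monomial. [folklore] -/
theorem re_sq_add_im_sq_mFourier (n : d → ℤ) (x : 𝕋) :
    (UnitAddTorus.mFourier n x).re ^ 2 + (UnitAddTorus.mFourier n x).im ^ 2 = 1 := by
  have h := norm_mFourier_apply n x
  rw [← Complex.normSq_add_mul_I, Complex.re_add_im, Complex.normSq_eq_norm_sq, h, one_pow]

/-! ## The elementary densities: positivity for `a₁² + a₂² ≤ 1` and behaviour under translation -/

/-- The elementary densities are nonnegative as soon as `a₁² + a₂² ≤ 1` (Cauchy–Schwarz in `ℝ²`).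
[folklore] -/
theorem modeDensity_nonneg_of_sq_le (n : d → ℤ) {a₁ a₂ : ℝ} (ha : a₁ ^ 2 + a₂ ^ 2 ≤ 1) (x : 𝕋) :
    0 ≤ modeDensity n a₁ a₂ x := by
  have h1 := re_sq_add_im_sq_mFourier n x
  set c := (UnitAddTorus.mFourier n x).re
  set s := (UnitAddTorus.mFourier n x).im
  unfold modeDensity
  nlinarith [sq_nonneg (a₁ * s - a₂ * c), sq_nonneg (a₁ + c), sq_nonneg (a₂ + s),
    sq_nonneg (1 + a₁ * c + a₂ * s), sq_nonneg (a₁ * c + a₂ * s + 1)]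

/-- The elementary densities are bounded by `2` as soon as `a₁² + a₂² ≤ 1`. [folklore] -/
theorem modeDensity_le_two_of_sq_le (n : d → ℤ) {a₁ a₂ : ℝ} (ha : a₁ ^ 2 + a₂ ^ 2 ≤ 1) (x : 𝕋) :
    modeDensity n a₁ a₂ x ≤ 2 := by
  have h1 := re_sq_add_im_sq_mFourier n x
  set c := (UnitAddTorus.mFourier n x).re
  set s := (UnitAddTorus.mFourier n x).im
  unfold modeDensity
  nlinarith [sq_nonneg (a₁ * s - a₂ * c), sq_nonneg (a₁ - c), sq_nonneg (a₂ - s),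
    sq_nonneg (1 - a₁ * c - a₂ * s)]

/-- **Translating an elementary density rotates its coefficients**:
`ρ_{n,a₁,a₂}(z + x) = ρ_{n,a₁',a₂'}(z)` with `a₁' = a₁ cos θ + a₂ sin θ`, `a₂' = a₂ cos θ - a₁ sin θ`,
`e_n(x) = cos θ + i sin θ`. [folklore] -/
theorem modeDensity_add (n : d → ℤ) (a₁ a₂ : ℝ) (z x : 𝕋) :
    modeDensity n a₁ a₂ (z + x) =
      modeDensity n (a₁ * (UnitAddTorus.mFourier n x).re + a₂ * (UnitAddTorus.mFourier n x).im)
        (a₂ * (UnitAddTorus.mFourier n x).re - a₁ * (UnitAddTorus.mFourier n x).im) z := by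
  simp only [modeDensity, mFourier_add_apply, Complex.mul_re, Complex.mul_im]
  ring

/-- The rotated coefficients have the same sum of squares. [folklore] -/
theorem sq_add_sq_rotate (a₁ a₂ : ℝ) (n : d → ℤ) (x : 𝕋) :
    (a₁ * (UnitAddTorus.mFourier n x).re + a₂ * (UnitAddTorus.mFourier n x).im) ^ 2 +
        (a₂ * (UnitAddTorus.mFourier n x).re - a₁ * (UnitAddTorus.mFourier n x).im) ^ 2 =
      a₁ ^ 2 + a₂ ^ 2 := by
  have h1 := re_sq_add_im_sq_mFourier n x
  linear_combination (a₁ ^ 2 + a₂ ^ 2) * h1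

/-! ## Linearity of the collision series over signed affine combinations -/

/-- **Affine linearity of the collision series.** If nonnegative continuous torus data satisfy
`f = K + c₁ g₁ + c₂ g₂` with constants `K, c₁, c₂` of arbitrary signs, then
`φ[f] = K + c₁ φ[g₁] + c₂ φ[g₂]`: move the negative parts to the other side and use additivity of
the series over nonnegative data (`linearBoltzmannSeries_add_torus`) and `φ[c] = c`. [folklore] -/
theorem linearBoltzmannSeries_affine (β α : ℝ) (hβ : 0 < β) (hα : 0 ≤ α) {f g₁ g₂ : 𝕋 → ℝ}
    (hf : Continuous f) (hg₁ : Continuous g₁) (hg₂ : Continuous g₂) (hf0 : ∀ x, 0 ≤ f x)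
    (hg₁0 : ∀ x, 0 ≤ g₁ x) (hg₂0 : ∀ x, 0 ≤ g₂ x) (K c₁ c₂ : ℝ)
    (hdec : ∀ x, f x = K + c₁ * g₁ x + c₂ * g₂ x) (t : ℝ) (x : 𝕋) (v : 𝔼) :
    linearBoltzmannSeries 𝔾 β α (fun x _ => f x) t x v =
      K + c₁ * linearBoltzmannSeries 𝔾 β α (fun x _ => g₁ x) t x v +
        c₂ * linearBoltzmannSeries 𝔾 β α (fun x _ => g₂ x) t x v := by
  -- positive and negative parts of the constants
  have hK := max_zero_sub_max_neg_zero_eq_self K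
  have hc₁ := max_zero_sub_max_neg_zero_eq_self c₁
  have hc₂ := max_zero_sub_max_neg_zero_eq_self c₂
  set Kp := max K 0
  set Km := max (-K) 0
  set c₁p := max c₁ 0
  set c₁m := max (-c₁) 0
  set c₂p := max c₂ 0
  set c₂m := max (-c₂) 0
  have hKm : 0 ≤ Km := le_max_right _ _
  have hKp : 0 ≤ Kp := le_max_right _ _
  have hc₁p : 0 ≤ c₁p := le_max_right _ _
  have hc₁m : 0 ≤ c₁m := le_max_right _ _
  have hc₂p : 0 ≤ c₂p := le_max_right _ _
  have hc₂m : 0 ≤ c₂m := le_max_right _ _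
  -- the identity between nonnegative data
  have hid : ∀ y, f y + Km + c₁m * g₁ y + c₂m * g₂ y = Kp + c₁p * g₁ y + c₂p * g₂ y := fun y => by
    rw [hdec y]; linear_combination -hK - g₁ y * hc₁ - g₂ y * hc₂
  set S := fun (h : 𝕋 → ℝ) => linearBoltzmannSeries 𝔾 β α (fun x _ => h x) t x v with hS
  -- continuity and positivity of the partial sums
  have c_f1 : Continuous fun y => f y + Km := hf.add continuous_const
  have c_f2 : Continuous fun y => f y + Km + c₁m * g₁ y := c_f1.add (continuous_const.mul hg₁)
  have c_g1 : Continuous fun y => c₁m * g₁ y := continuous_const.mul hg₁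
  have c_g2 : Continuous fun y => c₂m * g₂ y := continuous_const.mul hg₂
  have c_p1 : Continuous fun y => Kp + c₁p * g₁ y := continuous_const.add (continuous_const.mul hg₁)
  have c_q1 : Continuous fun y => c₁p * g₁ y := continuous_const.mul hg₁
  have c_q2 : Continuous fun y => c₂p * g₂ y := continuous_const.mul hg₂
  have p_f1 : ∀ y, 0 ≤ f y + Km := fun y => add_nonneg (hf0 y) hKm
  have p_g1 : ∀ y, 0 ≤ c₁m * g₁ y := fun y => mul_nonneg hc₁m (hg₁0 y)
  have p_g2 : ∀ y, 0 ≤ c₂m * g₂ y := fun y => mul_nonneg hc₂m (hg₂0 y)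
  have p_f2 : ∀ y, 0 ≤ f y + Km + c₁m * g₁ y := fun y => add_nonneg (p_f1 y) (p_g1 y)
  have p_q1 : ∀ y, 0 ≤ c₁p * g₁ y := fun y => mul_nonneg hc₁p (hg₁0 y)
  have p_q2 : ∀ y, 0 ≤ c₂p * g₂ y := fun y => mul_nonneg hc₂p (hg₂0 y)
  have p_p1 : ∀ y, 0 ≤ Kp + c₁p * g₁ y := fun y => add_nonneg hKp (p_q1 y)
  -- apply the series to both sides
  have lhs : linearBoltzmannSeries 𝔾 β α (fun y _ => f y + Km + c₁m * g₁ y + c₂m * g₂ y) t x v =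
      S f + Km + c₁m * S g₁ + c₂m * S g₂ := by
    rw [linearBoltzmannSeries_add_torus hβ hα c_f2 c_g2 p_f2 p_g2,
      linearBoltzmannSeries_add_torus hβ hα c_f1 c_g1 p_f1 p_g1,
      linearBoltzmannSeries_add_torus hβ hα hf continuous_const hf0 (fun _ => hKm),
      linearBoltzmannSeries_const_torus hβ hα]
    simp only [hS, linearBoltzmannSeries_const_mul]
  have rhs : linearBoltzmannSeries 𝔾 β α (fun y _ => Kp + c₁p * g₁ y + c₂p * g₂ y) t x v =
      Kp + c₁p * S g₁ + c₂p * S g₂ := by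
    rw [linearBoltzmannSeries_add_torus hβ hα c_p1 c_q2 p_p1 p_q2,
      linearBoltzmannSeries_add_torus hβ hα continuous_const c_q1 (fun _ => hKp) p_q1,
      linearBoltzmannSeries_const_torus hβ hα]
    simp only [hS, linearBoltzmannSeries_const_mul]
  have heq : (fun (y : 𝕋) (_ : 𝔼) => f y + Km + c₁m * g₁ y + c₂m * g₂ y) =
      fun (y : 𝕋) (_ : 𝔼) => Kp + c₁p * g₁ y + c₂p * g₂ y := by
    funext y w; exact hid y
  rw [heq, rhs] at lhs
  show S f = K + c₁ * S g₁ + c₂ * S g₂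
  linear_combination -lhs + hK + S g₁ * hc₁ + S g₂ * hc₂

/-! ## The velocity profile of a Fourier mode -/

/-- **The velocity profile `ĝ_n(t, v)` of the Fourier mode `n`** under BGSR's linear Boltzmann
equation (1.3) with inverse mean free path `α`: the complex function with
`φ[1 + Re(c e_n)](t, x, v) = 1 + Re(c e_n(x) ĝ_n(t, v))` for every `|c| ≤ 1`
(`linearBoltzmannSeries_modeDensity`), read off at `x = 0` from the collision series of the two
elementary data `1 + cos(2π n·x)` and `1 + sin(2π n·x)`. It solves the velocity-only equation
`∂ₜ ĝ = -i ω_n(v) ĝ - α L ĝ`, `ĝ(0) = 1` (`hasDerivAt_modeProfile`).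
[cite: BodineauGallagherSaintRaymondInvent2016, (1.3) and §6.1.1] -/
def modeProfile (n : d → ℤ) (β α : ℝ) (t : ℝ) (v : 𝔼) : ℂ :=
  ((linearBoltzmannSeries 𝔾 β α (fun x _ => modeDensity n 1 0 x) t 0 v - 1 : ℝ) : ℂ) +
    ((linearBoltzmannSeries 𝔾 β α (fun x _ => modeDensity n 0 1 x) t 0 v - 1 : ℝ) : ℂ) * Complex.I

/-- Real part of the velocity profile. [folklore] -/
theorem modeProfile_re (n : d → ℤ) (β α : ℝ) (t : ℝ) (v : 𝔼) :
    (modeProfile n β α t v).re =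
      linearBoltzmannSeries 𝔾 β α (fun x _ => modeDensity n 1 0 x) t 0 v - 1 := by
  simp [modeProfile]

/-- Imaginary part of the velocity profile. [folklore] -/
theorem modeProfile_im (n : d → ℤ) (β α : ℝ) (t : ℝ) (v : 𝔼) :
    (modeProfile n β α t v).im =
      linearBoltzmannSeries 𝔾 β α (fun x _ => modeDensity n 0 1 x) t 0 v - 1 := by
  simp [modeProfile]

/-- The elementary data are admissible for the collision series, with the bound `2`. [folklore] -/
theorem linearBoltzmannData_modeDensity {β α : ℝ} (hβ : 0 < β) (hα : 0 ≤ α) (n : d → ℤ)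
    {a₁ a₂ : ℝ} (ha : a₁ ^ 2 + a₂ ^ 2 ≤ 1) :
    LinearBoltzmannData 𝔾 β α (fun x _ => modeDensity n a₁ a₂ x) 2 :=
  linearBoltzmannData_torus hβ hα (continuous_modeDensity n a₁ a₂)
    (modeDensity_nonneg_of_sq_le n ha) (modeDensity_le_two_of_sq_le n ha)

/-- Step 1 of the separation of variables: by affine linearity,
`φ[ρ_{n,a₁,a₂}] = 1 + a₁ (φ[1 + cos] - 1) + a₂ (φ[1 + sin] - 1)`. [folklore] -/
theorem linearBoltzmannSeries_modeDensity_eq_affine {β α : ℝ} (hβ : 0 < β) (hα : 0 ≤ α)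
    (n : d → ℤ) {a₁ a₂ : ℝ} (ha : a₁ ^ 2 + a₂ ^ 2 ≤ 1) (t : ℝ) (x : 𝕋) (v : 𝔼) :
    linearBoltzmannSeries 𝔾 β α (fun x _ => modeDensity n a₁ a₂ x) t x v =
      1 + a₁ * (linearBoltzmannSeries 𝔾 β α (fun x _ => modeDensity n 1 0 x) t x v - 1) +
        a₂ * (linearBoltzmannSeries 𝔾 β α (fun x _ => modeDensity n 0 1 x) t x v - 1) := by
  have h10 : (1 : ℝ) ^ 2 + 0 ^ 2 ≤ 1 := by norm_num
  have h01 : (0 : ℝ) ^ 2 + 1 ^ 2 ≤ 1 := by norm_num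
  have h := linearBoltzmannSeries_affine β α hβ hα (continuous_modeDensity n a₁ a₂)
    (continuous_modeDensity n 1 0) (continuous_modeDensity n 0 1) (modeDensity_nonneg_of_sq_le n ha)
    (modeDensity_nonneg_of_sq_le n h10) (modeDensity_nonneg_of_sq_le n h01) (1 - a₁ - a₂) a₁ a₂
    (fun y => by simp only [modeDensity]; ring) t x v
  rw [h]
  ring

/-- **Separation of variables for single-mode data.** For `a₁² + a₂² ≤ 1`,
`φ[1 + a₁ cos(2π n·x) + a₂ sin(2π n·x)](t, x, v) = 1 + a₁ Re(e_n(x) ĝ_n(t, v)) + a₂ Im(e_n(x) ĝ_n(t, v))`: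
translation covariance turns the datum translated by `x` into an elementary density with rotated
coefficients, and affine linearity reads everything off at `x = 0`.
[cite: BodineauGallagherSaintRaymondInvent2016, §6.1.1] -/
theorem linearBoltzmannSeries_modeDensity {β α : ℝ} (hβ : 0 < β) (hα : 0 ≤ α) (n : d → ℤ)
    {a₁ a₂ : ℝ} (ha : a₁ ^ 2 + a₂ ^ 2 ≤ 1) (t : ℝ) (x : 𝕋) (v : 𝔼) :
    linearBoltzmannSeries 𝔾 β α (fun x _ => modeDensity n a₁ a₂ x) t x v =
      1 + a₁ * (UnitAddTorus.mFourier n x * modeProfile n β α t v).re +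
        a₂ * (UnitAddTorus.mFourier n x * modeProfile n β α t v).im := by
  set C := (UnitAddTorus.mFourier n x).re with hC
  set S := (UnitAddTorus.mFourier n x).im with hS
  have hCS : C ^ 2 + S ^ 2 = 1 := re_sq_add_im_sq_mFourier n x
  -- the two elementary series at `x`, by covariance and Step 1 at `0`
  have hcos : linearBoltzmannSeries 𝔾 β α (fun x _ => modeDensity n 1 0 x) t x v =
      1 + C * (modeProfile n β α t v).re - S * (modeProfile n β α t v).im := by
    have e1 : (fun (z : 𝕋) (_ : 𝔼) => modeDensity n 1 0 (z + x)) =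
        fun (z : 𝕋) (_ : 𝔼) => modeDensity n C (-S) z := by
      funext z w
      rw [modeDensity_add]
      congr 1 <;> simp [hC, hS]
    have hCS' : C ^ 2 + (-S) ^ 2 ≤ 1 := by nlinarith
    rw [← zero_add x, ← linearBoltzmannSeries_translate, e1,
      linearBoltzmannSeries_modeDensity_eq_affine hβ hα n hCS', modeProfile_re, modeProfile_im]
    ring
  have hsin : linearBoltzmannSeries 𝔾 β α (fun x _ => modeDensity n 0 1 x) t x v =
      1 + S * (modeProfile n β α t v).re + C * (modeProfile n β α t v).im := by
    have e1 : (fun (z : 𝕋) (_ : 𝔼) => modeDensity n 0 1 (z + x)) =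
        fun (z : 𝕋) (_ : 𝔼) => modeDensity n S C z := by
      funext z w
      rw [modeDensity_add]
      congr 1 <;> simp [hC, hS]
    have hCS' : S ^ 2 + C ^ 2 ≤ 1 := by nlinarith
    rw [← zero_add x, ← linearBoltzmannSeries_translate, e1,
      linearBoltzmannSeries_modeDensity_eq_affine hβ hα n hCS', modeProfile_re, modeProfile_im]
  rw [linearBoltzmannSeries_modeDensity_eq_affine hβ hα n ha, hcos, hsin]
  simp only [Complex.mul_re, Complex.mul_im, ← hC, ← hS]
  ring

/-! ### Elementary properties of the velocity profile -/

/-- The collision series of an elementary density takes values in `[0, 2]`. [folklore] -/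
theorem linearBoltzmannSeries_modeDensity_mem {β α : ℝ} (hβ : 0 < β) (hα : 0 ≤ α) (n : d → ℤ)
    {a₁ a₂ : ℝ} (ha : a₁ ^ 2 + a₂ ^ 2 ≤ 1) (t : ℝ) (x : 𝕋) (v : 𝔼) :
    0 ≤ linearBoltzmannSeries 𝔾 β α (fun x _ => modeDensity n a₁ a₂ x) t x v ∧
      linearBoltzmannSeries 𝔾 β α (fun x _ => modeDensity n a₁ a₂ x) t x v ≤ 2 :=
  (linearBoltzmannData_modeDensity hβ hα n ha).linearBoltzmannSeries_mem t x v

/-- `|Re ĝ_n| ≤ 1`. [folklore] -/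
theorem abs_re_modeProfile_le {β α : ℝ} (hβ : 0 < β) (hα : 0 ≤ α) (n : d → ℤ) (t : ℝ) (v : 𝔼) :
    |(modeProfile n β α t v).re| ≤ 1 := by
  have h := linearBoltzmannSeries_modeDensity_mem hβ hα n (a₁ := 1) (a₂ := 0) (by norm_num) t 0 v
  rw [modeProfile_re, abs_le]
  constructor <;> linarith [h.1, h.2]

/-- `|Im ĝ_n| ≤ 1`. [folklore] -/
theorem abs_im_modeProfile_le {β α : ℝ} (hβ : 0 < β) (hα : 0 ≤ α) (n : d → ℤ) (t : ℝ) (v : 𝔼) :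
    |(modeProfile n β α t v).im| ≤ 1 := by
  have h := linearBoltzmannSeries_modeDensity_mem hβ hα n (a₁ := 0) (a₂ := 1) (by norm_num) t 0 v
  rw [modeProfile_im, abs_le]
  constructor <;> linarith [h.1, h.2]

/-- `|ĝ_n| ≤ 2`. [folklore] -/
theorem norm_modeProfile_le {β α : ℝ} (hβ : 0 < β) (hα : 0 ≤ α) (n : d → ℤ) (t : ℝ) (v : 𝔼) :
    ‖modeProfile n β α t v‖ ≤ 2 :=
  (Complex.norm_le_abs_re_add_abs_im _).trans
    (by linarith [abs_re_modeProfile_le hβ hα n t v, abs_im_modeProfile_le hβ hα n t v])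

/-- Before time `0` (in particular at `t = 0`) the profile is `1`. [folklore] -/
theorem modeProfile_of_nonpos (n : d → ℤ) (β α : ℝ) {t : ℝ} (ht : t ≤ 0) (v : 𝔼) :
    modeProfile n β α t v = 1 := by
  apply Complex.ext
  · rw [modeProfile_re, linearBoltzmannSeries_of_nonpos _ _ _ _ ht]
    simp [modeDensity, mFourier_apply_zero]
  · rw [modeProfile_im, linearBoltzmannSeries_of_nonpos _ _ _ _ ht]
    simp [modeDensity, mFourier_apply_zero]

/-- `ĝ_n(0, v) = 1`. [folklore] -/
@[simp]
theorem modeProfile_zero (n : d → ℤ) (β α : ℝ) (v : 𝔼) : modeProfile n β α 0 v = 1 :=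
  modeProfile_of_nonpos n β α le_rfl v

/-- **Joint continuity of the velocity profile** in `(t, v)`. [folklore] -/
theorem continuous_modeProfile {β α : ℝ} (hβ : 0 < β) (hα : 0 ≤ α) (n : d → ℤ) :
    Continuous fun p : ℝ × 𝔼 => modeProfile n β α p.1 p.2 := by
  have h1 := (linearBoltzmannData_modeDensity hβ hα n (a₁ := 1) (a₂ := 0)
    (by norm_num)).continuous_linearBoltzmannSeries
  have h2 := (linearBoltzmannData_modeDensity hβ hα n (a₁ := 0) (a₂ := 1)
    (by norm_num)).continuous_linearBoltzmannSeries
  have e : Continuous fun p : ℝ × 𝔼 => (p.1, (0 : 𝕋), p.2) := by fun_prop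
  unfold modeProfile
  exact (Complex.continuous_ofReal.comp ((h1.comp e).sub continuous_const)).add
    ((Complex.continuous_ofReal.comp ((h2.comp e).sub continuous_const)).mul continuous_const)

/-- Continuity of the profile in the velocity. [folklore] -/
theorem continuous_modeProfile_right {β α : ℝ} (hβ : 0 < β) (hα : 0 ≤ α) (n : d → ℤ) (t : ℝ) :
    Continuous fun v : 𝔼 => modeProfile n β α t v :=
  (continuous_modeProfile hβ hα n).comp (Continuous.prodMk_right t)

/-- Continuity of the profile in time. [folklore] -/
theorem continuous_modeProfile_left {β α : ℝ} (hβ : 0 < β) (hα : 0 ≤ α) (n : d → ℤ) (v : 𝔼) :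
    Continuous fun t : ℝ => modeProfile n β α t v :=
  (continuous_modeProfile hβ hα n).comp (Continuous.prodMk_left v)

/-- Measurability of the profile in the velocity. [folklore] -/
theorem measurable_modeProfile_right {β α : ℝ} (hβ : 0 < β) (hα : 0 ≤ α) (n : d → ℤ) (t : ℝ) :
    Measurable fun v : 𝔼 => modeProfile n β α t v :=
  (continuous_modeProfile_right hβ hα n t).measurable

/-! ## The complexified gain operator -/

/-- The gain operator `K⁺_β` applied to a complex-valued velocity function (componentwise).
[folklore] -/
def cgain (β : ℝ) (ψ : 𝔼 → ℂ) (v : 𝔼) : ℂ :=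
  ((linearBoltzmannGain β (fun w => (ψ w).re) v : ℝ) : ℂ) +
    ((linearBoltzmannGain β (fun w => (ψ w).im) v : ℝ) : ℂ) * Complex.I

/-- Real part of the complexified gain. [folklore] -/
@[simp]
theorem cgain_re (β : ℝ) (ψ : 𝔼 → ℂ) (v : 𝔼) :
    (cgain β ψ v).re = linearBoltzmannGain β (fun w => (ψ w).re) v := by
  simp [cgain]

/-- Imaginary part of the complexified gain. [folklore] -/
@[simp]
theorem cgain_im (β : ℝ) (ψ : 𝔼 → ℂ) (v : 𝔼) :
    (cgain β ψ v).im = linearBoltzmannGain β (fun w => (ψ w).im) v := by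
  simp [cgain]

/-- A bounded function is quadratically bounded (for the additivity lemma of `K⁺`). [folklore] -/
theorem abs_le_quad_of_norm_le {ψ : 𝔼 → ℂ} {C : ℝ} (hC : ∀ w, ‖ψ w‖ ≤ C) (c : ℝ)
    (p : ℂ → ℝ) (hp : ∀ z, |p z| ≤ ‖z‖) (w : 𝔼) :
    |c * p (ψ w)| ≤ |c| * C * (1 + ‖w‖ ^ 2) := by
  rw [abs_mul]
  have h1 : |p (ψ w)| ≤ C := (hp _).trans (hC w)
  have hC0 : 0 ≤ C := (norm_nonneg _).trans (hC w)
  calc |c| * |p (ψ w)| ≤ |c| * C := mul_le_mul_of_nonneg_left h1 (abs_nonneg _)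
    _ ≤ |c| * C * (1 + ‖w‖ ^ 2) := le_mul_of_one_le_right (by positivity) (by nlinarith [sq_nonneg ‖w‖])

/-- **`ℂ`-linearity of the complexified gain** on bounded measurable functions:
`K⁺(c ψ) = c K⁺ ψ`. [folklore] -/
theorem cgain_const_mul {β : ℝ} (hβ : 0 < β) {ψ : 𝔼 → ℂ} (hψ : Measurable ψ) {C : ℝ}
    (hC : ∀ w, ‖ψ w‖ ≤ C) (c : ℂ) (v : 𝔼) :
    cgain β (fun w => c * ψ w) v = c * cgain β ψ v := by
  have hre : Measurable fun w => (ψ w).re := Complex.measurable_re.comp hψ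
  have him : Measurable fun w => (ψ w).im := Complex.measurable_im.comp hψ
  have b1 := abs_le_quad_of_norm_le hC c.re Complex.re Complex.abs_re_le_norm
  have b2 := abs_le_quad_of_norm_le hC (-c.im) Complex.im Complex.abs_im_le_norm
  have b3 := abs_le_quad_of_norm_le hC c.re Complex.im Complex.abs_im_le_norm
  have b4 := abs_le_quad_of_norm_le hC c.im Complex.re Complex.abs_re_le_norm
  apply Complex.ext
  · rw [cgain_re, Complex.mul_re, cgain_re, cgain_im]
    have e : (fun w => (c * ψ w).re) = fun w => c.re * (ψ w).re + -c.im * (ψ w).im := by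
      funext w; rw [Complex.mul_re]; ring
    rw [e, linearBoltzmannGain_add hβ (hre.const_mul _) (him.const_mul _) b1 b2,
      linearBoltzmannGain_const_mul, linearBoltzmannGain_const_mul]
    ring
  · rw [cgain_im, Complex.mul_im, cgain_re, cgain_im]
    have e : (fun w => (c * ψ w).im) = fun w => c.re * (ψ w).im + c.im * (ψ w).re := by
      funext w; rw [Complex.mul_im]
    rw [e, linearBoltzmannGain_add hβ (him.const_mul _) (hre.const_mul _) b3 b4,
      linearBoltzmannGain_const_mul, linearBoltzmannGain_const_mul]

/-- `K⁺(1 + Re(c ψ)) = a_β + Re(c K⁺ψ)`. [folklore] -/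
theorem linearBoltzmannGain_one_add_re {β : ℝ} (hβ : 0 < β) {ψ : 𝔼 → ℂ} (hψ : Measurable ψ)
    {C : ℝ} (hC : ∀ w, ‖ψ w‖ ≤ C) (c : ℂ) (v : 𝔼) :
    linearBoltzmannGain β (fun w => 1 + (c * ψ w).re) v =
      TaggedSphereDiffusion.collisionFrequency β v + (c * cgain β ψ v).re := by
  have hm : Measurable fun w => (c * ψ w).re := Complex.measurable_re.comp (hψ.const_mul c)
  have hb : ∀ w, |(c * ψ w).re| ≤ ‖c‖ * C * (1 + ‖w‖ ^ 2) := fun w => by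
    have h1 : |(c * ψ w).re| ≤ ‖c‖ * C :=
      (Complex.abs_re_le_norm _).trans (by rw [norm_mul]; exact mul_le_mul_of_nonneg_left (hC w) (norm_nonneg _))
    have hC0 : 0 ≤ C := (norm_nonneg _).trans (hC w)
    exact h1.trans (le_mul_of_one_le_right (by positivity) (by nlinarith [sq_nonneg ‖w‖]))
  have h1 : ∀ w : 𝔼, |(1 : ℝ)| ≤ 1 * (1 + ‖w‖ ^ 2) := fun w => by
    rw [abs_one, one_mul]; nlinarith [sq_nonneg ‖w‖]
  rw [linearBoltzmannGain_add hβ measurable_const hm h1 hb, linearBoltzmannGain_const, mul_one,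
    ← cgain_const_mul hβ hψ hC c v, cgain_re]

/-- `K⁺(1 + Im(c ψ)) = a_β + Im(c K⁺ψ)`. [folklore] -/
theorem linearBoltzmannGain_one_add_im {β : ℝ} (hβ : 0 < β) {ψ : 𝔼 → ℂ} (hψ : Measurable ψ)
    {C : ℝ} (hC : ∀ w, ‖ψ w‖ ≤ C) (c : ℂ) (v : 𝔼) :
    linearBoltzmannGain β (fun w => 1 + (c * ψ w).im) v =
      TaggedSphereDiffusion.collisionFrequency β v + (c * cgain β ψ v).im := by
  have hm : Measurable fun w => (c * ψ w).im := Complex.measurable_im.comp (hψ.const_mul c)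
  have hb : ∀ w, |(c * ψ w).im| ≤ ‖c‖ * C * (1 + ‖w‖ ^ 2) := fun w => by
    have h1 : |(c * ψ w).im| ≤ ‖c‖ * C :=
      (Complex.abs_im_le_norm _).trans (by rw [norm_mul]; exact mul_le_mul_of_nonneg_left (hC w) (norm_nonneg _))
    have hC0 : 0 ≤ C := (norm_nonneg _).trans (hC w)
    exact h1.trans (le_mul_of_one_le_right (by positivity) (by nlinarith [sq_nonneg ‖w‖]))
  have h1 : ∀ w : 𝔼, |(1 : ℝ)| ≤ 1 * (1 + ‖w‖ ^ 2) := fun w => by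
    rw [abs_one, one_mul]; nlinarith [sq_nonneg ‖w‖]
  rw [linearBoltzmannGain_add hβ measurable_const hm h1 hb, linearBoltzmannGain_const, mul_one,
    ← cgain_const_mul hβ hψ hC c v, cgain_im]

/-- `|K⁺ ψ| ≤ 2 a_β C` for `|ψ| ≤ C`. [folklore] -/
theorem norm_cgain_le {β : ℝ} (hβ : 0 < β) {ψ : 𝔼 → ℂ} {C : ℝ} (hC : ∀ w, ‖ψ w‖ ≤ C) (v : 𝔼) :
    ‖cgain β ψ v‖ ≤ 2 * TaggedSphereDiffusion.collisionFrequency β v * C := by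
  have h1 := abs_linearBoltzmannGain_le hβ (φ := fun w => (ψ w).re) (C := C)
    (fun w => (Complex.abs_re_le_norm _).trans (hC w)) v
  have h2 := abs_linearBoltzmannGain_le hβ (φ := fun w => (ψ w).im) (C := C)
    (fun w => (Complex.abs_im_le_norm _).trans (hC w)) v
  refine (Complex.norm_le_abs_re_add_abs_im _).trans ?_
  rw [cgain_re, cgain_im]
  linarith

/-! ## The velocity-only equation solved by the profile -/

/-- The slices of the elementary series along a free flight, in terms of the profile:
`φ[1 + cos](t, s v, w) = 1 + Re(e^{i s ω_n(v)} ĝ_n(t, w))`. [folklore] -/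
theorem modeSeries_cos_slice [DecidableEq d] {β α : ℝ} (hβ : 0 < β) (hα : 0 ≤ α) (n : d → ℤ) (t s : ℝ)
    (v w : 𝔼) :
    linearBoltzmannSeries 𝔾 β α (fun x _ => modeDensity n 1 0 x) t ((𝔾).translate 0 (s • v)) w =
      1 + (Complex.exp ((s * modePhase n v : ℝ) * Complex.I) * modeProfile n β α t w).re := by
  rw [linearBoltzmannSeries_modeDensity hβ hα n (a₁ := 1) (a₂ := 0) (by norm_num),
    torusGeometry_translate, zero_add, mFourier_proj_modePhase, modePhase_smul]
  ring

/-- `φ[1 + sin](t, s v, w) = 1 + Im(e^{i s ω_n(v)} ĝ_n(t, w))`. [folklore] -/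
theorem modeSeries_sin_slice [DecidableEq d] {β α : ℝ} (hβ : 0 < β) (hα : 0 ≤ α) (n : d → ℤ) (t s : ℝ)
    (v w : 𝔼) :
    linearBoltzmannSeries 𝔾 β α (fun x _ => modeDensity n 0 1 x) t ((𝔾).translate 0 (s • v)) w =
      1 + (Complex.exp ((s * modePhase n v : ℝ) * Complex.I) * modeProfile n β α t w).im := by
  rw [linearBoltzmannSeries_modeDensity hβ hα n (a₁ := 0) (a₂ := 1) (by norm_num),
    torusGeometry_translate, zero_add, mFourier_proj_modePhase, modePhase_smul]
  ring

/-- The rotating phase `s ↦ e^{-i s ω}` and its derivative. [folklore] -/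
theorem hasDerivAt_exp_neg_phase (ω s : ℝ) :
    HasDerivAt (fun s : ℝ => Complex.exp (-((s * ω : ℝ) : ℂ) * Complex.I))
      (-(ω * Complex.I) * Complex.exp (-((s * ω : ℝ) : ℂ) * Complex.I)) s := by
  have h1 : HasDerivAt (fun s : ℝ => -((s * ω : ℝ) : ℂ) * Complex.I) (-(ω : ℂ) * Complex.I) s := by
    have h2 : HasDerivAt (fun s : ℝ => ((s * ω : ℝ) : ℂ)) (ω : ℂ) s := by
      have := ((hasDerivAt_id s).mul_const ω).ofReal_comp
      simpa using this
    exact (h2.neg).mul_const _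
  have := h1.cexp
  convert this using 1
  ring

/-- **The velocity-only linear Boltzmann equation for the profile.** For `t > 0` and every
`v`, `s ↦ ĝ_n(s, v)` is differentiable at `t` with
`∂ₜ ĝ_n(t, v) = -i ω_n(v) ĝ_n(t, v) + α [(K⁺_β ĝ_n(t, ·))(v) - a_β(v) ĝ_n(t, v)]`
(the Fourier transform in `x` of (1.3): `∂ₜ φ + v·∇ₓ φ = -α L φ`, `L = a_β - K⁺_β`): Duhamel's
formula for the two elementary series along the free flight `s ↦ s v` from `x = 0`, the
fundamental theorem of calculus, and the separation of variables.
[cite: BodineauGallagherSaintRaymondInvent2016, (1.3) and §6.1.2] -/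
theorem hasDerivAt_modeProfile [DecidableEq d] {β α : ℝ} (hβ : 0 < β) (hα : 0 ≤ α) (n : d → ℤ) {t : ℝ}
    (ht : 0 < t) (v : 𝔼) :
    HasDerivAt (fun s => modeProfile n β α s v)
      (-(modePhase n v * Complex.I) * modeProfile n β α t v +
        α * (cgain β (fun w => modeProfile n β α t w) v -
          TaggedSphereDiffusion.collisionFrequency β v * modeProfile n β α t v)) t := by
  set ω := modePhase n v with hω
  set a := TaggedSphereDiffusion.collisionFrequency β v with ha
  have h10 : (1 : ℝ) ^ 2 + 0 ^ 2 ≤ 1 := by norm_num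
  have h01 : (0 : ℝ) ^ 2 + 1 ^ 2 ≤ 1 := by norm_num
  have Dc := linearBoltzmannData_modeDensity hβ hα n h10
  have Ds := linearBoltzmannData_modeDensity hβ hα n h01
  -- the two real slices along the flow and their Duhamel integrands
  set Sc := linearBoltzmannSeries 𝔾 β α (fun x _ => modeDensity n 1 0 x) with hSc
  set Ss := linearBoltzmannSeries 𝔾 β α (fun x _ => modeDensity n 0 1 x) with hSs
  set Fc : ℝ → ℝ := fun s => Sc s ((𝔾).translate 0 (s • v)) v with hFc
  set Fs : ℝ → ℝ := fun s => Ss s ((𝔾).translate 0 (s • v)) v with hFs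
  set Hc : ℝ → ℝ := fun τ => α * linearBoltzmannGain β (fun w => Sc τ ((𝔾).translate 0 (τ • v)) w) v -
    α * a * Sc τ ((𝔾).translate 0 (τ • v)) v with hHc
  set Hs : ℝ → ℝ := fun τ => α * linearBoltzmannGain β (fun w => Ss τ ((𝔾).translate 0 (τ • v)) w) v -
    α * a * Ss τ ((𝔾).translate 0 (τ • v)) v with hHs
  have hflow : Continuous fun τ : ℝ => (τ, (𝔾).translate 0 (τ • v), v) :=
    continuous_id.prodMk ((Dc.continuous_translate.comp
      (continuous_const.prodMk (continuous_id.smul continuous_const))).prodMk continuous_const)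
  have cHc : Continuous Hc :=
    (continuous_const.mul (Dc.continuous_gain_alongFlow 0 v)).sub
      (continuous_const.mul (Dc.continuous_linearBoltzmannSeries.comp hflow))
  have cHs : Continuous Hs :=
    (continuous_const.mul (Ds.continuous_gain_alongFlow 0 v)).sub
      (continuous_const.mul (Ds.continuous_linearBoltzmannSeries.comp hflow))
  have duh_c : ∀ s, 0 ≤ s → Fc s = modeDensity n 1 0 0 + ∫ τ in (0 : ℝ)..s, Hc τ :=
    fun s hs => Dc.linearBoltzmannSeries_duhamel hs 0 v
  have duh_s : ∀ s, 0 ≤ s → Fs s = modeDensity n 0 1 0 + ∫ τ in (0 : ℝ)..s, Hs τ :=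
    fun s hs => Ds.linearBoltzmannSeries_duhamel hs 0 v
  -- derivatives of the real slices
  have dFc : HasDerivAt Fc (Hc t) t := by
    have h1 := intervalIntegral.integral_hasDerivAt_right (cHc.intervalIntegrable 0 t)
      (cHc.stronglyMeasurableAtFilter _ _) cHc.continuousAt
    refine ((h1.const_add (modeDensity n 1 0 0)).congr_of_eventuallyEq ?_)
    filter_upwards [Ioi_mem_nhds ht] with s hs
    exact duh_c s (le_of_lt hs)
  have dFs : HasDerivAt Fs (Hs t) t := by
    have h1 := intervalIntegral.integral_hasDerivAt_right (cHs.intervalIntegrable 0 t)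
      (cHs.stronglyMeasurableAtFilter _ _) cHs.continuousAt
    refine ((h1.const_add (modeDensity n 0 1 0)).congr_of_eventuallyEq ?_)
    filter_upwards [Ioi_mem_nhds ht] with s hs
    exact duh_s s (le_of_lt hs)
  -- the complex slice `F = Fc + i Fs = (1 + i) + e^{iωs} ĝ(s)`
  have dF : HasDerivAt (fun s => (Fc s : ℂ) + (Fs s : ℂ) * Complex.I)
      ((Hc t : ℂ) + (Hs t : ℂ) * Complex.I) t :=
    dFc.ofReal_comp.add (dFs.ofReal_comp.mul_const _)
  have hF : ∀ s, (Fc s : ℂ) + (Fs s : ℂ) * Complex.I =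
      (1 + Complex.I) + Complex.exp ((s * ω : ℝ) * Complex.I) * modeProfile n β α s v := by
    intro s
    have h1 : Fc s = 1 + (Complex.exp ((s * ω : ℝ) * Complex.I) * modeProfile n β α s v).re :=
      modeSeries_cos_slice hβ hα n s s v v
    have h2 : Fs s = 1 + (Complex.exp ((s * ω : ℝ) * Complex.I) * modeProfile n β α s v).im :=
      modeSeries_sin_slice hβ hα n s s v v
    rw [h1, h2]
    set z := Complex.exp ((s * ω : ℝ) * Complex.I) * modeProfile n β α s v
    rw [← Complex.re_add_im z]
    simp only [Complex.add_re, Complex.add_im, Complex.ofReal_re, Complex.ofReal_im,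
      Complex.mul_re, Complex.mul_im, Complex.I_re, Complex.I_im]
    push_cast
    ring
  -- `ĝ(s) = e^{-iωs} (F(s) - (1 + i))`
  have hg : ∀ s, modeProfile n β α s v =
      Complex.exp (-((s * ω : ℝ) : ℂ) * Complex.I) * ((Fc s : ℂ) + (Fs s : ℂ) * Complex.I - (1 + Complex.I)) := by
    intro s
    rw [hF s, add_sub_cancel_left, ← mul_assoc, ← Complex.exp_add]
    have : -((s * ω : ℝ) : ℂ) * Complex.I + ((s * ω : ℝ) : ℂ) * Complex.I = 0 := by ring
    rw [this, Complex.exp_zero, one_mul]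
  have dg : HasDerivAt (fun s => modeProfile n β α s v)
      (-(ω * Complex.I) * Complex.exp (-((t * ω : ℝ) : ℂ) * Complex.I) *
          ((Fc t : ℂ) + (Fs t : ℂ) * Complex.I - (1 + Complex.I)) +
        Complex.exp (-((t * ω : ℝ) : ℂ) * Complex.I) * ((Hc t : ℂ) + (Hs t : ℂ) * Complex.I)) t := by
    have h := (hasDerivAt_exp_neg_phase ω t).mul (dF.sub_const (1 + Complex.I))
    have e : (fun s => modeProfile n β α s v) = fun s =>
        Complex.exp (-((s * ω : ℝ) : ℂ) * Complex.I) * ((Fc s : ℂ) + (Fs s : ℂ) * Complex.I - (1 + Complex.I)) :=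
      funext hg
    rw [e]
    exact h
  -- identification of the derivative
  have hmeas := measurable_modeProfile_right hβ hα n t
  have hbd := norm_modeProfile_le hβ hα n t
  set c := Complex.exp ((t * ω : ℝ) * Complex.I) with hc_def
  have hHc_val : Hc t = α * (c * (cgain β (fun w => modeProfile n β α t w) v -
      a * modeProfile n β α t v)).re := by
    have e1 : (fun w => Sc t ((𝔾).translate 0 (t • v)) w) =
        fun w => 1 + (c * modeProfile n β α t w).re := funext fun w => modeSeries_cos_slice hβ hα n t t v w
    have e2 : Sc t ((𝔾).translate 0 (t • v)) v = 1 + (c * modeProfile n β α t v).re :=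
      modeSeries_cos_slice hβ hα n t t v v
    simp only [hHc]
    rw [e1, linearBoltzmannGain_one_add_re hβ hmeas hbd c v, e2]
    simp only [← ha, Complex.mul_re, Complex.sub_re, Complex.sub_im, Complex.mul_im,
      Complex.ofReal_re, Complex.ofReal_im]
    ring
  have hHs_val : Hs t = α * (c * (cgain β (fun w => modeProfile n β α t w) v -
      a * modeProfile n β α t v)).im := by
    have e1 : (fun w => Ss t ((𝔾).translate 0 (t • v)) w) =
        fun w => 1 + (c * modeProfile n β α t w).im := funext fun w => modeSeries_sin_slice hβ hα n t t v w
    have e2 : Ss t ((𝔾).translate 0 (t • v)) v = 1 + (c * modeProfile n β α t v).im :=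
      modeSeries_sin_slice hβ hα n t t v v
    simp only [hHs]
    rw [e1, linearBoltzmannGain_one_add_im hβ hmeas hbd c v, e2]
    simp only [← ha, Complex.mul_re, Complex.sub_re, Complex.sub_im, Complex.mul_im,
      Complex.ofReal_re, Complex.ofReal_im]
    ring
  have hH : (Hc t : ℂ) + (Hs t : ℂ) * Complex.I =
      α * (c * (cgain β (fun w => modeProfile n β α t w) v - a * modeProfile n β α t v)) := by
    set z := c * (cgain β (fun w => modeProfile n β α t w) v - a * modeProfile n β α t v)
    rw [hHc_val, hHs_val]
    have hz : (α : ℂ) * z = ((α * z.re : ℝ) : ℂ) + ((α * z.im : ℝ) : ℂ) * Complex.I := by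
      conv_lhs => rw [← Complex.re_add_im z]
      push_cast
      ring
    rw [hz]
  have hcc : Complex.exp (-((t * ω : ℝ) : ℂ) * Complex.I) * c = 1 := by
    rw [hc_def, ← Complex.exp_add]
    have : -((t * ω : ℝ) : ℂ) * Complex.I + ((t * ω : ℝ) : ℂ) * Complex.I = 0 := by ring
    rw [this, Complex.exp_zero]
  convert dg using 1
  rw [hH, mul_assoc, ← hg t]
  linear_combination (-(α : ℂ) * (cgain β (fun w => modeProfile n β α t w) v -
    (a : ℂ) * modeProfile n β α t v)) * hcc

/-! ### The right-hand side of the velocity equation as a function of `(t, v)` -/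

/-- The right-hand side `Γ_n(t, v) = -i ω_n(v) ĝ_n(t, v) + α (K⁺_β ĝ_n(t, ·)(v) - a_β(v) ĝ_n(t, v))`
of the velocity-only equation, as a function of all `(t, v)` (it is the time derivative of the
profile for `t > 0`, `hasDerivAt_modeProfile'`). [folklore] -/
def modeDeriv [DecidableEq d] (n : d → ℤ) (β α : ℝ) (t : ℝ) (v : 𝔼) : ℂ :=
  -(modePhase n v * Complex.I) * modeProfile n β α t v +
    α * (cgain β (fun w => modeProfile n β α t w) v -
      TaggedSphereDiffusion.collisionFrequency β v * modeProfile n β α t v)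

/-- `∂ₜ ĝ_n(t, v) = Γ_n(t, v)` for `t > 0`. [cite: BodineauGallagherSaintRaymondInvent2016, (1.3)] -/
theorem hasDerivAt_modeProfile' [DecidableEq d] {β α : ℝ} (hβ : 0 < β) (hα : 0 ≤ α) (n : d → ℤ)
    {t : ℝ} (ht : 0 < t) (v : 𝔼) :
    HasDerivAt (fun s => modeProfile n β α s v) (modeDeriv n β α t v) t :=
  hasDerivAt_modeProfile hβ hα n ht v

/-- Real part of `Γ_n`: `ω_n Im ĝ + α (K⁺ Re ĝ - a_β Re ĝ)`. [folklore] -/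
theorem modeDeriv_re [DecidableEq d] (n : d → ℤ) (β α : ℝ) (t : ℝ) (v : 𝔼) :
    (modeDeriv n β α t v).re = modePhase n v * (modeProfile n β α t v).im +
      α * (linearBoltzmannGain β (fun w => (modeProfile n β α t w).re) v -
        TaggedSphereDiffusion.collisionFrequency β v * (modeProfile n β α t v).re) := by
  simp only [modeDeriv, Complex.add_re, Complex.mul_re, Complex.neg_re, Complex.neg_im,
    Complex.mul_im, Complex.ofReal_re, Complex.ofReal_im, Complex.I_re, Complex.I_im,
    Complex.sub_re, Complex.sub_im, cgain_re, cgain_im]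
  ring

/-- Imaginary part of `Γ_n`: `-ω_n Re ĝ + α (K⁺ Im ĝ - a_β Im ĝ)`. [folklore] -/
theorem modeDeriv_im [DecidableEq d] (n : d → ℤ) (β α : ℝ) (t : ℝ) (v : 𝔼) :
    (modeDeriv n β α t v).im = -(modePhase n v * (modeProfile n β α t v).re) +
      α * (linearBoltzmannGain β (fun w => (modeProfile n β α t w).im) v -
        TaggedSphereDiffusion.collisionFrequency β v * (modeProfile n β α t v).im) := by
  simp only [modeDeriv, Complex.add_im, Complex.mul_re, Complex.neg_re, Complex.neg_im,
    Complex.mul_im, Complex.ofReal_re, Complex.ofReal_im, Complex.I_re, Complex.I_im,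
    Complex.sub_re, Complex.sub_im, cgain_re, cgain_im]
  ring

/-- **Size of `Γ_n`**: `|Γ_n(t, v)| ≤ 2 |ω_n(v)| + 6 α a_β(v)` (`|ĝ| ≤ 2`, `|K⁺ ĝ| ≤ 4 a_β`).
[folklore] -/
theorem norm_modeDeriv_le [DecidableEq d] {β α : ℝ} (hβ : 0 < β) (hα : 0 ≤ α) (n : d → ℤ)
    (t : ℝ) (v : 𝔼) :
    ‖modeDeriv n β α t v‖ ≤
      2 * |modePhase n v| + 6 * α * TaggedSphereDiffusion.collisionFrequency β v := by
  have hg := norm_modeProfile_le hβ hα n t v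
  have hK := norm_cgain_le hβ (ψ := fun w => modeProfile n β α t w) (norm_modeProfile_le hβ hα n t) v
  have ha := TaggedLinearBoltzmannSeries.collisionFrequency_nonneg hβ v
  set a := TaggedSphereDiffusion.collisionFrequency β v
  set g := modeProfile n β α t v
  set Kg := cgain β (fun w => modeProfile n β α t w) v
  have h1 : ‖-(modePhase n v * Complex.I) * g‖ ≤ |modePhase n v| * 2 := by
    rw [norm_mul, norm_neg, norm_mul, Complex.norm_I, mul_one, Complex.norm_real, Real.norm_eq_abs]
    exact mul_le_mul_of_nonneg_left hg (abs_nonneg _)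
  have h2 : ‖(α : ℂ) * (Kg - a * g)‖ ≤ α * (2 * a * 2 + a * 2) := by
    rw [norm_mul, Complex.norm_real, Real.norm_of_nonneg hα]
    refine mul_le_mul_of_nonneg_left ((norm_sub_le _ _).trans (add_le_add hK ?_)) hα
    rw [norm_mul, Complex.norm_real, Real.norm_of_nonneg ha]
    exact mul_le_mul_of_nonneg_left hg ha
  calc ‖modeDeriv n β α t v‖ ≤ ‖-(modePhase n v * Complex.I) * g‖ + ‖(α : ℂ) * (Kg - a * g)‖ :=
        norm_add_le _ _
    _ ≤ |modePhase n v| * 2 + α * (2 * a * 2 + a * 2) := add_le_add h1 h2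
    _ = 2 * |modePhase n v| + 6 * α * a := by ring

/-- Joint continuity of `(t, v) ↦ K⁺_β ĝ_n(t, ·)(v)` (parametric continuity of the gain operator).
[folklore] -/
theorem continuous_cgain_modeProfile {β α : ℝ} (hβ : 0 < β) (hα : 0 ≤ α) (n : d → ℤ) :
    Continuous fun p : ℝ × 𝔼 => cgain β (fun w => modeProfile n β α p.1 w) p.2 := by
  have hc := continuous_modeProfile hβ hα n
  have hj : Continuous fun q : (ℝ × 𝔼) × 𝔼 => modeProfile n β α q.1.1 q.2 :=
    hc.comp (continuous_fst.fst.prodMk continuous_snd)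
  have hre := continuous_linearBoltzmannGain_param (Y := ℝ × 𝔼) hβ
    (h := fun p w => (modeProfile n β α p.1 w).re) (Complex.continuous_re.comp hj)
    (C := 1) (fun p w => abs_re_modeProfile_le hβ hα n p.1 w) continuous_snd
  have him := continuous_linearBoltzmannGain_param (Y := ℝ × 𝔼) hβ
    (h := fun p w => (modeProfile n β α p.1 w).im) (Complex.continuous_im.comp hj)
    (C := 1) (fun p w => abs_im_modeProfile_le hβ hα n p.1 w) continuous_snd
  unfold cgain
  exact (Complex.continuous_ofReal.comp hre).add ((Complex.continuous_ofReal.comp him).mul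
    continuous_const)

/-- **Joint continuity of `Γ_n`** in `(t, v)`. [folklore] -/
theorem continuous_modeDeriv [DecidableEq d] {β α : ℝ} (hβ : 0 < β) (hα : 0 ≤ α) (n : d → ℤ) :
    Continuous fun p : ℝ × 𝔼 => modeDeriv n β α p.1 p.2 := by
  have hc := continuous_modeProfile hβ hα n
  have hK := continuous_cgain_modeProfile hβ hα n
  have hω : Continuous fun p : ℝ × 𝔼 => ((modePhase n p.2 : ℝ) : ℂ) :=
    Complex.continuous_ofReal.comp ((continuous_modePhase n).comp continuous_snd)
  have ha : Continuous fun p : ℝ × 𝔼 => ((TaggedSphereDiffusion.collisionFrequency β p.2 : ℝ) : ℂ) :=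
    Complex.continuous_ofReal.comp ((continuous_collisionFrequency hβ).comp continuous_snd)
  unfold modeDeriv
  exact ((hω.mul continuous_const).neg.mul hc).add (continuous_const.mul (hK.sub (ha.mul hc)))

/-! ## The heat flow of a Fourier mode -/

/-- **The wrapped heat kernel acts diagonally on Fourier monomials**:
`∫ e_n(x - proj(√(2κτ) Z)) dγ(Z) = e^{-4π² κ |n|² τ} e_n(x)` for `κτ ≥ 0` (the characteristic
function of the standard Gaussian, `charFun_stdGaussian`). [folklore] -/
theorem integral_mFourier_heatKernel [DecidableEq d] {κ τ : ℝ} (hκτ : 0 ≤ κ * τ) (n : d → ℤ) (x : 𝕋) :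
    ∫ z, UnitAddTorus.mFourier n
        (x - Literature.Analysis.FunctionSpaces.Torus.proj (Real.sqrt (2 * κ * τ) • z)) ∂stdGaussian 𝔼 =
      UnitAddTorus.mFourier n x *
        (Real.exp (-(4 * Real.pi ^ 2 * κ * ‖Literature.Analysis.FunctionSpaces.Torus.latticeVec n‖ ^ 2 * τ)) : ℂ) := by
  set σ := Real.sqrt (2 * κ * τ) with hσ
  have hσ2 : σ ^ 2 = 2 * κ * τ := Real.sq_sqrt (by nlinarith)
  have hpt : ∀ z : 𝔼, UnitAddTorus.mFourier n
      (x - Literature.Analysis.FunctionSpaces.Torus.proj (σ • z)) =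
      UnitAddTorus.mFourier n x *
        Complex.exp ((⟪z, (-(2 * Real.pi * σ)) • Literature.Analysis.FunctionSpaces.Torus.latticeVec n⟫_ℝ : ℝ) * Complex.I) := by
    intro z
    rw [sub_eq_add_neg, ← Literature.Analysis.FunctionSpaces.Torus.proj_neg, mFourier_add_apply,
      mFourier_proj_modePhase, modePhase_neg, modePhase_smul, modePhase, inner_smul_right, real_inner_comm]
    congr 2
    push_cast
    ring
  simp_rw [hpt]
  rw [integral_const_mul, ← charFun_apply, charFun_stdGaussian]
  congr 1
  rw [norm_smul, norm_neg, Real.norm_of_nonneg (by positivity : (0 : ℝ) ≤ 2 * Real.pi * σ),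
    Complex.ofReal_exp]
  have hσ2' : (σ : ℂ) ^ 2 = 2 * (κ : ℂ) * (τ : ℂ) := by
    rw [← Complex.ofReal_pow, hσ2]; push_cast; ring
  congr 1
  push_cast
  rw [mul_pow, mul_pow, mul_pow, hσ2']
  ring

/-- The mode integrand against the heat kernel is integrable. [folklore] -/
theorem integrable_mFourier_heatKernel (κ τ : ℝ) (n : d → ℤ) (x : 𝕋) :
    Integrable (fun z : 𝔼 => UnitAddTorus.mFourier n
      (x - Literature.Analysis.FunctionSpaces.Torus.proj (Real.sqrt (2 * κ * τ) • z))) (stdGaussian 𝔼) := by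
  have hc : Continuous fun z : 𝔼 => UnitAddTorus.mFourier n
      (x - Literature.Analysis.FunctionSpaces.Torus.proj (Real.sqrt (2 * κ * τ) • z)) :=
    (UnitAddTorus.mFourier n).continuous.comp (continuous_const.sub
      (Literature.Analysis.FunctionSpaces.Torus.continuous_proj.comp (continuous_const_smul _)))
  refine Integrable.mono' (integrable_const (1 : ℝ)) hc.aestronglyMeasurable
    (Eventually.of_forall fun z => ?_)
  rw [norm_mFourier_apply]

/-- **The heat flow of an elementary density**:
`(G_{2κτ} * ρ_{n,a₁,a₂})(x) = 1 + e^{-4π² κ |n|² τ} (a₁ cos(2π n·x) + a₂ sin(2π n·x))` for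
`κτ ≥ 0` — the solution of `∂_τ ρ = κ Δ ρ` (BGSR (2.11)) from the datum `ρ_{n,a₁,a₂}`.
[cite: BodineauGallagherSaintRaymondInvent2016, (2.11)] -/
theorem torusHeatSolution_modeDensity [DecidableEq d] {κ τ : ℝ} (hκτ : 0 ≤ κ * τ) (n : d → ℤ) (a₁ a₂ : ℝ)
    (x : 𝕋) :
    torusHeatSolution κ (modeDensity n a₁ a₂) τ x =
      1 + Real.exp (-(4 * Real.pi ^ 2 * κ * ‖Literature.Analysis.FunctionSpaces.Torus.latticeVec n‖ ^ 2 * τ)) *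
        (a₁ * (UnitAddTorus.mFourier n x).re + a₂ * (UnitAddTorus.mFourier n x).im) := by
  unfold torusHeatSolution modeDensity
  set F : 𝔼 → ℂ := fun z => UnitAddTorus.mFourier n
    (x - Literature.Analysis.FunctionSpaces.Torus.proj (Real.sqrt (2 * κ * τ) • z)) with hF
  have hFi : Integrable F (stdGaussian 𝔼) := integrable_mFourier_heatKernel κ τ n x
  have hre : Integrable (fun z => (F z).re) (stdGaussian 𝔼) := hFi.re
  have him : Integrable (fun z => (F z).im) (stdGaussian 𝔼) := hFi.im
  have h1 : Integrable (fun z => (1 : ℝ) + a₁ * (F z).re) (stdGaussian 𝔼) :=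
    (integrable_const _).add (hre.const_mul _)
  have hsum : ∫ z, (1 : ℝ) + a₁ * (F z).re + a₂ * (F z).im ∂stdGaussian 𝔼 =
      1 + a₁ * (∫ z, F z ∂stdGaussian 𝔼).re + a₂ * (∫ z, F z ∂stdGaussian 𝔼).im := by
    rw [integral_add h1 (him.const_mul _), integral_add (integrable_const _) (hre.const_mul _),
      integral_const_mul, integral_const_mul]
    simp only [integral_const, smul_eq_mul, mul_one, probReal_univ]
    have e1 : ∫ z, (F z).re ∂stdGaussian 𝔼 = (∫ z, F z ∂stdGaussian 𝔼).re :=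
      integral_re hFi
    have e2 : ∫ z, (F z).im ∂stdGaussian 𝔼 = (∫ z, F z ∂stdGaussian 𝔼).im :=
      integral_im hFi
    rw [e1, e2]
  have hint : ∫ z, F z ∂stdGaussian 𝔼 = UnitAddTorus.mFourier n x *
      (Real.exp (-(4 * Real.pi ^ 2 * κ * ‖Literature.Analysis.FunctionSpaces.Torus.latticeVec n‖ ^ 2 * τ)) : ℂ) :=
    integral_mFourier_heatKernel hκτ n x
  show ∫ z, (1 : ℝ) + a₁ * (F z).re + a₂ * (F z).im ∂stdGaussian 𝔼 = _
  rw [hsum, hint]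
  simp only [Complex.mul_re, Complex.mul_im, Complex.ofReal_re, Complex.ofReal_im]
  ring

/-! ## Reduction of (6.3) for a single mode to the relaxation of the velocity profile -/

/-- `(|a₁| + |a₂|)² ≥ a₁² + a₂²`. [folklore] -/
theorem sq_add_sq_le_one_of_abs {a₁ a₂ : ℝ} (ha : |a₁| + |a₂| ≤ 1) : a₁ ^ 2 + a₂ ^ 2 ≤ 1 := by
  nlinarith [abs_nonneg a₁, abs_nonneg a₂, sq_abs a₁, sq_abs a₂]

/-- `|a₁ Re z + a₂ Im z| ≤ |z|` when `a₁² + a₂² ≤ 1` (Cauchy–Schwarz in `ℝ²`). [folklore] -/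
theorem abs_re_im_comb_le {a₁ a₂ : ℝ} (ha : a₁ ^ 2 + a₂ ^ 2 ≤ 1) (z : ℂ) :
    |a₁ * z.re + a₂ * z.im| ≤ ‖z‖ := by
  refine abs_le_of_sq_le_sq ?_ (norm_nonneg z)
  rw [Complex.sq_norm, Complex.normSq_apply]
  nlinarith [sq_nonneg (a₁ * z.im - a₂ * z.re), sq_nonneg z.re, sq_nonneg z.im,
    mul_nonneg (sub_nonneg.2 ha) (add_nonneg (sq_nonneg z.re) (sq_nonneg z.im))]

/-- **(6.3) for a single Fourier mode from the relaxation of its velocity profile.** If for every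
`d ≥ 2`, `β > 0`, corrector `b`, mode `n ≠ 0`, `T > 0` and `e > 0` there is `α₀ ≥ 0` beyond which
`M_β(v) |ĝ_n(ατ, v) - e^{-4π² κ_β |n|² τ}| ≤ e` for all `τ ∈ [0, T]` and `v`, then
`bgsr_hydrodynamicLimit_mode` holds: every solution in the class is the collision series
(`IsTaggedLinearBoltzmannSolution.eq_linearBoltzmannSeries`), which separates
(`linearBoltzmannSeries_modeDensity`), and so does the heat flow
(`torusHeatSolution_modeDensity`); the difference is `a₁ Re(e_n(x) r) + a₂ Im(e_n(x) r)` with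
`r = ĝ_n(ατ, v) - e^{-4π² κ_β |n|² τ}`, of modulus `≤ |r|`.
[cite: BodineauGallagherSaintRaymondInvent2016, (6.3) and §6.1.1] -/
theorem bgsr_hydrodynamicLimit_mode_of_profile [DecidableEq d]
    (h : ∀ (_ : 2 ≤ Fintype.card d) {β : ℝ} (_ : 0 < β) (b : 𝔼 → 𝔼) (_ : IsDiffusionCorrector β b)
      (n : d → ℤ) (_ : n ≠ 0) {T : ℝ} (_ : 0 < T) {e : ℝ} (_ : 0 < e),
      ∃ α₀ : ℝ, 0 ≤ α₀ ∧ ∀ α : ℝ, α₀ ≤ α → ∀ τ ∈ Icc 0 T, ∀ v : 𝔼,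
        maxwellianBeta β v * ‖modeProfile n β α (α * τ) v -
          (Real.exp (-(4 * Real.pi ^ 2 * bgsrDiffusionCoeff β b * ‖Literature.Analysis.FunctionSpaces.Torus.latticeVec n‖ ^ 2 * τ)) : ℂ)‖ ≤ e) :
    bgsr_hydrodynamicLimit_mode (d := d) := by
  intro hd β hβ b hb n hn a₁ a₂ ha T hT e he
  obtain ⟨α₀, hα₀0, hα₀⟩ := h hd hβ b hb n hn hT he
  refine ⟨α₀, fun α hα φ hφ τ hτ x v => ?_⟩
  have hα0 : 0 ≤ α := hα₀0.trans hα
  have ht : 0 ≤ α * τ := mul_nonneg hα0 hτ.1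
  have ha2 : a₁ ^ 2 + a₂ ^ 2 ≤ 1 := sq_add_sq_le_one_of_abs ha
  have hκ : 0 < bgsrDiffusionCoeff β b := bgsr_diffusionCoeff_pos_holds hd hβ b hb
  have hκτ : 0 ≤ bgsrDiffusionCoeff β b * τ := mul_nonneg hκ.le hτ.1
  set E : ℝ := Real.exp (-(4 * Real.pi ^ 2 * bgsrDiffusionCoeff β b * ‖Literature.Analysis.FunctionSpaces.Torus.latticeVec n‖ ^ 2 * τ)) with hE
  set g : ℂ := modeProfile n β α (α * τ) v with hg
  set ex : ℂ := UnitAddTorus.mFourier n x with hex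
  rw [congrFun (congrFun (hφ.eq_linearBoltzmannSeries hβ hα0 ht) x) v,
    linearBoltzmannSeries_modeDensity hβ hα0 n ha2, torusHeatSolution_modeDensity hκτ n a₁ a₂ x]
  have key : 1 + a₁ * (ex * g).re + a₂ * (ex * g).im - (1 + E * (a₁ * ex.re + a₂ * ex.im)) =
      a₁ * (ex * (g - E)).re + a₂ * (ex * (g - E)).im := by
    simp only [Complex.mul_re, Complex.mul_im, Complex.sub_re, Complex.sub_im, Complex.ofReal_re,
      Complex.ofReal_im]
    ring
  rw [key]
  have h1 : |a₁ * (ex * (g - E)).re + a₂ * (ex * (g - E)).im| ≤ ‖g - E‖ := by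
    refine (abs_re_im_comb_le ha2 _).trans ?_
    rw [norm_mul, hex, norm_mFourier_apply, one_mul]
  exact (mul_le_mul_of_nonneg_left h1 (maxwellianBeta_pos hβ v).le).trans (hα₀ α hα τ hτ v)

end

end Literature.MathematicalPhysics.KineticTheory
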